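import Summits.Schanuel.Schanuel.Theorems.DiophantineDichotomyKhovanskiiApproxTypeSiegelBox
import Summits.Schanuel.Schanuel.Theorems.DiophantineDichotomyKhovanskiiApproxTypeTransferOfSiegelLemmas
import Summits.Schanuel.Schanuel.Theorems.KhovanskiiApproxType.Negative.SlotFloorDirichlet

/-!
# Dirichlet tightness of the codimension-one measures in `m` variables
# (crux `KhovanskiiApproxType`, stmt-Schanuel-6116, negative lane; line `lw-small-height`)

Vocabulary of line `lw-small-height` (`Theorems/DiophantineDichotomyDefs.lean`): a DECOUPLED
CODIMENSION-ONE MEASURE `CodimOneMeasure m ω μ K C` at `ω ∈ ℂᵐ` is the lower bound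
`log|P(ω)| ≥ −C((max 1 deg P)^μ · log(max 1 H(P)) + (max 1 deg P)^K)` for every non-zero
`P ∈ ℤ[X₁,…,X_m]` (total degree, naive height).  The line's inputs `LWSmallHeight m` /
`LWPenaltyMeasure` (Ably 1994) assert such measures at `(e^{y₁},…,e^{y_m})` with `μ = m`, and the
`n = 2` inputs stub `NonLWInputsTwo` asks for `μ` with `A(μ+1) < 2(A+1)` together with slot floors of
exponent `A`.

This file (refuter, drefute pass on the stub set) proves, sorry-free, the MULTIVARIATE DIRICHLET BOX
PRINCIPLE and its consequences for the stub set: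

* `exists_mvPoly_small_value` — for every `ω ∈ ℂᵐ`, box size `t` and height `B ≥ 1` there is a
  non-zero `P ∈ ℤ[X₁,…,X_m]` supported on the box `[0,t]^m` (so `deg P ≤ m t`), of naive height `≤ B`,
  with `‖P(ω)‖ ≤ 4·(t+1)^m·B·M^{m(t+1)} / B^k`, `k = ⌊((t+1)^m − 1)/2⌋`, `M = max 1 (Σ‖ωⱼ‖)`
  (pigeonhole `siegel_exists_near` + box polynomials `siegel_boxPoly` of the landed Siegel-box module).
* `codimOne_dirichlet` — THE ENGINE, uniform in the penalty: for `μ < m` (`m ≥ 1`), every `C > 0` and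
  EVERY height-free penalty function `Φ` of the degree, some non-zero `P` has
  `‖P(ω)‖ < exp(−(C (max 1 deg P)^μ log(max 1 H(P)) + Φ(max 1 deg P)))`.  (So it refutes the
  polynomial-penalty class `CodimOneMeasure` and, by the same one-line instantiation, the Ably penalty
  class `CodimOneMeasureX` of skeleton `Lines/height_window_compactness.lean`, for every `μ < m`.)
* `codimOneMeasure_false_of_lt` — `μ < m → ¬ CodimOneMeasure m ω μ K C`: the degree exponent
  `μ = m` claimed by `LWSmallHeight m` / `LWPenaltyMeasure` is the Dirichlet boundary — best possible,
  no slack (Ably 1994 p. 29: `Φ ≤ H^{−Dᵐ/(3·m!)}`), `lwSmallHeight_exponent_sharp`.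
* `nonLWInputsTwo_window` — in `NonLWInputsTwo` the data `(μ, A)` necessarily satisfy
  `1 ≤ A < 2` and `2 ≤ μ < 3` (floors: `slotFloor_false_of_lt_one`; pair: this file); i.e. the stub
  demands, at every non-Lindemann–Weierstrass free Khovanskii point of `ℂ²`, a pair measure within
  `1` of the Dirichlet exponent AND floors within `1` of the Dirichlet exponent at both slots — at the
  flagship `s = (1, iπ)` this is an algebraic-independence measure for `(iπ, e)` with `μ < 3` and a
  polynomial-penalty floor for `e` with `A < 2`, neither in print (recorded for the lead; not a
  refutation).
[cite: Bugeaud2004, Lemma 8.1] [folklore]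
-/

noncomputable section

set_option linter.dupNamespace false

open scoped BigOperators

namespace Summit.Schanuel.Schanuel.Cruxes.KhovanskiiApproxType.Negative

open Summit.Schanuel.Schanuel.Cruxes.KhovanskiiApproxType.LwSmallHeight

/-! ## The multivariate box principle -/

/-- **Multivariate Dirichlet.** For `ω ∈ ℂᵐ`, a box size `t` with `(t+1)^m ≥ 3` and a height
`B ≥ 1` there is a non-zero integer polynomial supported on the box `[0,t]^m`, of naive height `≤ B`,
with `‖P(ω)‖ ≤ 4 (t+1)^m B M^{m(t+1)} / B^k`, `k = ⌊((t+1)^m − 1)/2⌋`, `M = max 1 (Σⱼ ‖ωⱼ‖)`.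
[folklore] -/
theorem exists_mvPoly_small_value (m t B : ℕ) (ω : Fin m → ℂ) (hB : 1 ≤ B)
    (hN : 3 ≤ (t + 1) ^ m) :
    ∃ P : MvPolynomial (Fin m) ℤ, P ≠ 0 ∧ (∀ e ∈ P.support, ∀ i, e i ≤ t) ∧ mvNatHeight P ≤ B ∧
      ‖MvPolynomial.aeval ω P‖ ≤
        4 * ((((t + 1) ^ m : ℕ) : ℝ) * B * (max 1 (∑ j, ‖ω j‖)) ^ (m * (t + 1))) /
          ((B : ℝ) ^ (((t + 1) ^ m - 1) / 2)) := by
  classical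
  set N : ℕ := (t + 1) ^ m with hNdef
  set k : ℕ := (N - 1) / 2 with hkdef
  set Mb : ℝ := max 1 (∑ j, ‖ω j‖) with hMb
  have hMb1 : 1 ≤ Mb := le_max_left _ _
  have hωMb : ∀ j, ‖ω j‖ ≤ Mb := fun j =>
    le_trans (Finset.single_le_sum (f := fun j => ‖ω j‖) (fun i _ => norm_nonneg _)
      (Finset.mem_univ j)) (le_max_right _ _)
  -- the linear forms `c ↦ Σ_e c_e ω^e`, `c_e ∈ {0,…,B}`
  set f : ((Fin m → Fin (t + 1)) → Fin (B + 1)) → ℂ :=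
    fun c => ∑ e, ((c e : ℕ) : ℂ) * ∏ j, ω j ^ (e j : ℕ) with hfdef
  set R : ℝ := (t + 1) ^ m * B * ∏ _j : Fin m, Mb ^ (t + 1) with hRdef
  have hfR : ∀ c, ‖f c‖ ≤ R := fun c =>
    siegel_norm_linearForm_le ω (fun _ => Mb) hωMb (fun _ => hMb1) c
  have hB0 : (0 : ℝ) < B := by exact_mod_cast hB
  have hR0 : 0 < R := by
    rw [hRdef]
    have h1 : (0 : ℝ) < (t + 1) ^ m := by positivity
    have h2 : (0 : ℝ) < ∏ _j : Fin m, Mb ^ (t + 1) :=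
      Finset.prod_pos fun j _ => pow_pos (by linarith) _
    positivity
  -- pigeonhole parameters: n = B^k, (n+1)^2 ≤ (B+1)^(2k) < (B+1)^N
  have hk1 : 1 ≤ k := by
    rw [hkdef]; omega
  have h2k : 2 * k < N := by rw [hkdef]; omega
  set n : ℕ := B ^ k with hndef
  have hn0 : 0 < n := by rw [hndef]; exact pow_pos hB k
  have hcard : (n + 1) ^ 2 < Fintype.card ((Fin m → Fin (t + 1)) → Fin (B + 1)) := by
    have hbox : Fintype.card ((Fin m → Fin (t + 1)) → Fin (B + 1)) = (B + 1) ^ N := by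
      simp [hNdef]
    rw [hbox]
    have h1 : n + 1 ≤ (B + 1) ^ k := by
      rw [hndef]
      exact Nat.pow_lt_pow_left (Nat.lt_succ_self B) (by omega)
    calc (n + 1) ^ 2 ≤ ((B + 1) ^ k) ^ 2 := Nat.pow_le_pow_left h1 2
      _ = (B + 1) ^ (2 * k) := by rw [← pow_mul, mul_comm]
      _ < (B + 1) ^ N := Nat.pow_lt_pow_right (by omega) h2k
  obtain ⟨a, b, hab, hnear⟩ := siegel_exists_near f hR0 hn0 hfR hcard
  -- the difference of the two coefficient vectors
  set c : (Fin m → Fin (t + 1)) → ℤ := fun e => (a e : ℕ) - (b e : ℕ) with hcdef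
  have hc0 : c ≠ 0 := by
    intro hc
    apply hab
    funext e
    have he : c e = 0 := by rw [hc]; rfl
    rw [hcdef] at he
    apply Fin.ext
    simp only at he
    omega
  have hcB : ∀ e, (c e).natAbs ≤ B := by
    intro e
    have ha := Nat.lt_succ_iff.mp (a e).is_lt
    have hb := Nat.lt_succ_iff.mp (b e).is_lt
    rw [hcdef]
    simp only
    omega
  obtain ⟨Q, hQ0, hQbox, hQht, hQval⟩ := siegel_boxPoly c hc0 hcB
  refine ⟨Q, hQ0, hQbox, hQht, ?_⟩
  have hval : MvPolynomial.aeval ω Q = f a - f b := by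
    rw [hQval ω, hfdef]
    simp only
    rw [← Finset.sum_sub_distrib]
    refine Finset.sum_congr rfl fun e _ => ?_
    rw [hcdef]
    push_cast
    ring
  rw [hval]
  refine hnear.trans ?_
  rw [hRdef, hndef, Finset.prod_const, Finset.card_univ, Fintype.card_fin, ← pow_mul,
    mul_comm (t + 1) m]
  push_cast
  rw [hNdef]
  push_cast
  exact le_refl _

/-! ## Parameters -/

/-- Choice of the box size: for `μ' < m` some `t ≥ 2` has `4 C (m t)^{μ'} + 8 ≤ (t+1)^m`. -/
theorem exists_box_param (m : ℕ) (hm : 1 ≤ m) (μ' C : ℝ) (hμ0 : 0 ≤ μ') (hμ : μ' < m)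
    (hC : 0 ≤ C) :
    ∃ t : ℕ, 2 ≤ t ∧ 4 * C * ((m : ℝ) * t) ^ μ' + 8 ≤ ((t : ℝ) + 1) ^ m := by
  set A : ℝ := 4 * C * (m : ℝ) ^ μ' + 8 with hA
  have hA8 : 8 ≤ A := by
    have : 0 ≤ 4 * C * (m : ℝ) ^ μ' := by positivity
    linarith
  have hApos : 0 < A := by linarith
  set e : ℝ := 1 / ((m : ℝ) - μ') with he
  have hgap : 0 < (m : ℝ) - μ' := by linarith
  refine ⟨max 2 ⌈A ^ e⌉₊, le_max_left _ _, ?_⟩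
  set t : ℕ := max 2 ⌈A ^ e⌉₊ with ht
  have hAt : A ^ e ≤ (t : ℝ) :=
    (Nat.le_ceil _).trans (by exact_mod_cast le_max_right 2 ⌈A ^ e⌉₊)
  have ht2 : (2 : ℝ) ≤ t := by exact_mod_cast le_max_left 2 ⌈A ^ e⌉₊
  have htpos : (0 : ℝ) < t := by linarith
  -- t^(m - μ') ≥ A
  have h1 : A ≤ (t : ℝ) ^ ((m : ℝ) - μ') := by
    have h := Real.rpow_le_rpow (by positivity) hAt hgap.le
    rwa [← Real.rpow_mul hApos.le, show e * ((m : ℝ) - μ') = 1 by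
      rw [he, one_div, inv_mul_cancel₀ hgap.ne'], Real.rpow_one] at h
  -- t^m = t^μ' · t^(m-μ') ≥ t^μ' · A
  have htm : ((t : ℝ) + 1) ^ m ≥ (t : ℝ) ^ (m : ℝ) := by
    rw [Real.rpow_natCast]
    exact pow_le_pow_left₀ htpos.le (by linarith) m
  have hsplit : (t : ℝ) ^ (m : ℝ) = (t : ℝ) ^ μ' * (t : ℝ) ^ ((m : ℝ) - μ') := by
    rw [← Real.rpow_add htpos, add_sub_cancel]
  have htμ1 : 1 ≤ (t : ℝ) ^ μ' := Real.one_le_rpow (by linarith) hμ0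
  have htμ0 : 0 ≤ (t : ℝ) ^ μ' := by positivity
  have hmt : ((m : ℝ) * t) ^ μ' = (m : ℝ) ^ μ' * (t : ℝ) ^ μ' :=
    Real.mul_rpow (Nat.cast_nonneg _) htpos.le
  have hkey : (t : ℝ) ^ μ' * A ≤ (t : ℝ) ^ (m : ℝ) := by
    rw [hsplit]; exact mul_le_mul_of_nonneg_left h1 htμ0
  have hA' : 4 * C * ((m : ℝ) * t) ^ μ' + 8 ≤ (t : ℝ) ^ μ' * A := by
    rw [hmt, hA]
    have h8 : (8 : ℝ) ≤ 8 * (t : ℝ) ^ μ' := by nlinarith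
    have hCm : 0 ≤ 4 * C * (m : ℝ) ^ μ' := by positivity
    nlinarith
  linarith

/-- The final comparison of the two exponential scales (real arithmetic). -/
theorem dirichlet_arith (N k D C P M Φm lB : ℝ) (hk : N - 2 ≤ 2 * k) (hN : 4 * C * P + 8 ≤ N)
    (hC : 0 ≤ C) (hP : 0 ≤ P) (hD : 0 ≤ D) (hM : 1 ≤ M)
    (hlB : Real.log (4 * N) + D * Real.log M + |Φm| + 1 ≤ lB) :
    Real.log (4 * N) + lB + D * Real.log M - k * lB < -(C * P * lB + Φm) := by
  have hN' : 4 * (C * P) + 8 ≤ N := by rw [mul_assoc] at hN; exact hN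
  set Q : ℝ := C * P with hQ
  have hQ0 : 0 ≤ Q := mul_nonneg hC hP
  have hlog4N : 0 ≤ Real.log (4 * N) := Real.log_nonneg (by linarith)
  have hlogM : 0 ≤ Real.log M := Real.log_nonneg hM
  have hDM : 0 ≤ D * Real.log M := mul_nonneg hD hlogM
  have habs : Φm ≤ |Φm| := le_abs_self _
  have habs0 : 0 ≤ |Φm| := abs_nonneg _
  have hlB1 : 1 ≤ lB := by linarith
  -- the coefficient of lB: k - 1 - Q ≥ N/4 ≥ 2
  have hcoef : 2 ≤ k - 1 - Q := by linarith
  have hprod : 2 * lB ≤ (k - 1 - Q) * lB := mul_le_mul_of_nonneg_right hcoef (by linarith)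
  have hexp : (k - 1 - Q) * lB = k * lB - lB - Q * lB := by ring
  rw [hexp] at hprod
  linarith

/-! ## The engine: no codimension-one measure with degree exponent `μ < m`, whatever the penalty -/

set_option maxHeartbeats 800000 in
/-- **Dirichlet beats every degree exponent `μ < m` in `m` variables, uniformly in the height-free
penalty.** For `m ≥ 1`, `ω ∈ ℂᵐ`, `μ < m`, `C > 0` and ANY function `Φ` (penalty depending on the
degree only) there is a non-zero `P ∈ ℤ[X₁,…,X_m]` with
`‖P(ω)‖ < exp(−(C·(max 1 deg P)^μ·log(max 1 H(P)) + Φ(max 1 deg P)))`.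
Instances: `Φ D = C·D^K` refutes `CodimOneMeasure m ω μ K C` (`codimOneMeasure_false_of_lt`);
`Φ D = exp(κ Dᵐ log(D+2))` refutes the Ably-class `CodimOneMeasureX m ω μ κ C` of skeleton
`Lines/height_window_compactness.lean` verbatim. [folklore] -/
theorem codimOne_dirichlet (m : ℕ) (hm : 1 ≤ m) (ω : Fin m → ℂ) (μ C : ℝ) (hμ : μ < m)
    (hC : 0 < C) (Φ : ℝ → ℝ) :
    ∃ P : MvPolynomial (Fin m) ℤ, P ≠ 0 ∧
      ‖MvPolynomial.aeval ω P‖ <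
        Real.exp (-(C * (max 1 (P.totalDegree : ℝ)) ^ μ * Real.log (max 1 (mvNatHeight P : ℝ)) +
          Φ (max 1 (P.totalDegree : ℝ)))) := by
  classical
  set μ' : ℝ := max μ 0 with hμ'
  have hμ'0 : 0 ≤ μ' := le_max_right _ _
  have hm1 : (1 : ℝ) ≤ m := by exact_mod_cast hm
  have hμ'm : μ' < m := max_lt hμ (by linarith)
  obtain ⟨t, ht2, ht⟩ := exists_box_param m hm μ' C hμ'0 hμ'm hC.le
  -- sizes
  set N : ℕ := (t + 1) ^ m with hNdef
  set k : ℕ := (N - 1) / 2 with hkdef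
  set D : ℝ := (m : ℝ) * (t + 1) with hDdef
  set Pw : ℝ := ((m : ℝ) * t) ^ μ' with hPw
  set Mb : ℝ := max 1 (∑ j, ‖ω j‖) with hMb
  have hMb1 : 1 ≤ Mb := le_max_left _ _
  have hNreal : (N : ℝ) = ((t : ℝ) + 1) ^ m := by rw [hNdef]; push_cast; ring
  have hN8 : (8 : ℝ) ≤ N := by
    rw [hNreal]
    have : 0 ≤ 4 * C * ((m : ℝ) * t) ^ μ' := by positivity
    linarith
  have hN3 : 3 ≤ (t + 1) ^ m := by
    have : (3 : ℝ) ≤ ((t + 1) ^ m : ℕ) := by rw [← hNdef]; linarith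
    exact_mod_cast this
  have hN1 : (1 : ℝ) ≤ N := by linarith
  -- the penalty, maximised over the finitely many possible degrees `0 … m t`
  set S : Finset ℝ := (Finset.range (m * t + 1)).image fun d : ℕ => Φ (max 1 (d : ℝ)) with hS
  have hSne : S.Nonempty := ⟨Φ (max 1 ((0 : ℕ) : ℝ)), Finset.mem_image.mpr ⟨0, by simp, rfl⟩⟩
  set Φm : ℝ := S.sup' hSne id with hΦm
  have hΦle : ∀ d : ℕ, d ≤ m * t → Φ (max 1 (d : ℝ)) ≤ Φm := by
    intro d hd
    have hmem : Φ (max 1 (d : ℝ)) ∈ S :=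
      Finset.mem_image.mpr ⟨d, Finset.mem_range.mpr (by omega), rfl⟩
    exact Finset.le_sup' id hmem
  -- the height scale
  set lB₀ : ℝ := Real.log (4 * N) + D * Real.log Mb + |Φm| + 1 with hlB₀
  have hlog4N : 0 ≤ Real.log (4 * (N : ℝ)) := Real.log_nonneg (by linarith)
  have hD0 : 0 ≤ D := by positivity
  have hDM : 0 ≤ D * Real.log Mb := mul_nonneg hD0 (Real.log_nonneg hMb1)
  have hlB₀1 : 1 ≤ lB₀ := by have := abs_nonneg Φm; linarith
  set B : ℕ := ⌈Real.exp lB₀⌉₊ with hBdef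
  have hBexp : Real.exp lB₀ ≤ (B : ℝ) := Nat.le_ceil _
  have hB1r : (1 : ℝ) ≤ B := le_trans (by have := Real.add_one_le_exp lB₀; linarith) hBexp
  have hB1 : 1 ≤ B := by exact_mod_cast hB1r
  have hB0r : (0 : ℝ) < B := by linarith
  have hlB : lB₀ ≤ Real.log B := by
    rw [Real.le_log_iff_exp_le hB0r]; exact hBexp
  have hlogB0 : 0 ≤ Real.log B := le_trans (by linarith) hlB
  -- Dirichlet
  obtain ⟨P, hP0, hPbox, hPht, hPval⟩ := exists_mvPoly_small_value m t B ω hB1 hN3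
  refine ⟨P, hP0, ?_⟩
  -- degree and height of `P`
  have hdeg : P.totalDegree ≤ m * t := TransferOfSiegel.totalDegree_le_of_box P hPbox
  set X₁ : ℝ := max 1 (P.totalDegree : ℝ) with hX₁
  set Y₁ : ℝ := max 1 (mvNatHeight P : ℝ) with hY₁
  have hX1 : 1 ≤ X₁ := le_max_left _ _
  have ht1 : (1 : ℝ) ≤ t := by exact_mod_cast (le_trans (by norm_num) ht2)
  have hmt1 : (1 : ℝ) ≤ (m : ℝ) * t := one_le_mul_of_one_le_of_one_le hm1 ht1
  have hXmt : X₁ ≤ (m : ℝ) * t := max_le hmt1 (by exact_mod_cast hdeg)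
  have hY1 : 1 ≤ Y₁ := le_max_left _ _
  have hYB : Y₁ ≤ B := max_le hB1r (by exact_mod_cast hPht)
  have hlogY : Real.log Y₁ ≤ Real.log B := Real.log_le_log (by linarith) hYB
  have hlogY0 : 0 ≤ Real.log Y₁ := Real.log_nonneg hY1
  have hXμ : X₁ ^ μ ≤ Pw :=
    (Real.rpow_le_rpow_of_exponent_le hX1 (le_max_left _ _)).trans
      (Real.rpow_le_rpow (by linarith) hXmt hμ'0)
  have hPw0 : 0 ≤ Pw := by positivity
  have hΦX : Φ X₁ ≤ Φm := by
    have : X₁ = max 1 ((P.totalDegree : ℕ) : ℝ) := rfl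
    rw [this]; exact hΦle _ hdeg
  -- the measure-type exponent at `P` is at most `C Pw log B + Φm`
  have hexpo : C * X₁ ^ μ * Real.log Y₁ + Φ X₁ ≤ C * Pw * Real.log B + Φm := by
    have h1 : X₁ ^ μ * Real.log Y₁ ≤ Pw * Real.log B := mul_le_mul hXμ hlogY hlogY0 hPw0
    have h2 := mul_le_mul_of_nonneg_left h1 hC.le
    nlinarith
  -- Dirichlet's upper bound in exponential form
  have hkreal : (N : ℝ) - 2 ≤ 2 * (k : ℝ) := by
    have h : N - 1 ≤ 2 * k + 1 := by rw [hkdef]; omega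
    have h' : ((N - 1 : ℕ) : ℝ) ≤ 2 * (k : ℝ) + 1 := by exact_mod_cast h
    have hN1n : 1 ≤ N := by exact_mod_cast hN1
    rw [Nat.cast_sub hN1n] at h'
    push_cast at h'
    linarith
  have hup : ‖MvPolynomial.aeval ω P‖ ≤
      Real.exp (Real.log (4 * N) + Real.log B + D * Real.log Mb - k * Real.log B) := by
    refine hPval.trans ?_
    have hBk : (0 : ℝ) < (B : ℝ) ^ k := pow_pos hB0r k
    rw [div_le_iff₀ (by rw [← hkdef]; exact hBk)]
    have hexp : Real.exp (Real.log (4 * N) + Real.log B + D * Real.log Mb - k * Real.log B) *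
        (B : ℝ) ^ k = 4 * N * B * Mb ^ (m * (t + 1)) := by
      rw [show Real.log (4 * N) + Real.log B + D * Real.log Mb - k * Real.log B =
          Real.log (4 * N) + Real.log B + D * Real.log Mb + -(k * Real.log B) by ring]
      rw [Real.exp_add, Real.exp_add, Real.exp_add, Real.exp_log (by linarith),
        Real.exp_log hB0r, Real.exp_neg]
      rw [show D * Real.log Mb = ((m * (t + 1) : ℕ) : ℝ) * Real.log Mb by
          rw [hDdef]; push_cast; ring]
      rw [← Real.log_pow, Real.exp_log (pow_pos (by linarith) _)]
      rw [show (k : ℝ) * Real.log B = Real.log ((B : ℝ) ^ k) by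
          rw [Real.log_pow]]
      rw [Real.exp_log hBk]
      field_simp
    rw [← hkdef, hexp, ← hNdef, ← hMb]
    nlinarith [le_refl ((4 : ℝ) * N * B * Mb ^ (m * (t + 1)))]
  -- compare
  have harith := dirichlet_arith (N : ℝ) k D C Pw Mb Φm (Real.log B) hkreal
    (by rw [hNreal]; exact ht) hC.le hPw0 hD0 hMb1 (by rw [← hlB₀]; exact hlB)
  calc ‖MvPolynomial.aeval ω P‖
      ≤ Real.exp (Real.log (4 * N) + Real.log B + D * Real.log Mb - k * Real.log B) := hup
    _ < Real.exp (-(C * Pw * Real.log B + Φm)) := Real.exp_lt_exp.mpr harith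
    _ ≤ Real.exp (-(C * X₁ ^ μ * Real.log Y₁ + Φ X₁)) := Real.exp_le_exp.mpr (by linarith)

/-! ## Consequences for the stub set of line `lw-small-height` -/

/-- **No decoupled codimension-one measure with degree exponent `μ < m` exists, at any `ω ∈ ℂᵐ`**
(`m ≥ 1`): the exponent `μ = m` of `LWSmallHeight m` / `LWPenaltyMeasure` is the Dirichlet boundary.
[folklore] -/
theorem codimOneMeasure_false_of_lt (m : ℕ) (hm : 1 ≤ m) (ω : Fin m → ℂ) (μ K C : ℝ)
    (hμ : μ < m) : ¬ CodimOneMeasure m ω μ K C := by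
  rintro ⟨hC, hmeas⟩
  obtain ⟨P, hP0, hP⟩ := codimOne_dirichlet m hm ω μ C hμ hC (fun D => C * D ^ K)
  have h := hmeas P hP0
  have h' : C * ((max 1 (P.totalDegree : ℝ)) ^ μ * Real.log (max 1 (mvNatHeight P : ℝ)) +
      (max 1 (P.totalDegree : ℝ)) ^ K) =
      C * (max 1 (P.totalDegree : ℝ)) ^ μ * Real.log (max 1 (mvNatHeight P : ℝ)) +
        C * (max 1 (P.totalDegree : ℝ)) ^ K := by ring
  rw [h'] at h
  exact absurd (lt_of_le_of_lt h hP) (lt_irrefl _)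

/-- The Lindemann–Weierstrass stubs claim the SHARP exponent: at `(e^{y₁},…,e^{y_m})` (indeed at any
point of `ℂᵐ`) no measure of the shape of `LWSmallHeight m` with `m` replaced by any `μ < m` holds.
[folklore] -/
theorem lwSmallHeight_exponent_sharp (m : ℕ) (hm : 1 ≤ m) (y : Fin m → ℂ) (μ K C : ℝ)
    (hμ : μ < m) : ¬ CodimOneMeasure m (Complex.exp ∘ y) μ K C :=
  codimOneMeasure_false_of_lt m hm _ μ K C hμ

/-- **The window of `NonLWInputsTwo`.** If a pair `θ ∘ e` of coordinates of `θ = (s, e^s) ∈ ℂ⁴`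
carries a decoupled codimension-one measure with exponent `μ` and floors with exponent `A > 0` at
both slots, in the stub's race window `A(μ+1) < 2(A+1)`, then necessarily `1 ≤ A < 2` and
`2 ≤ μ < 3` (Dirichlet in one and in two variables).  So the stub asks, at every non-LW free
Khovanskii point of `ℂ²`, for BOTH a pair measure and two floors within `1` of the Dirichlet
exponents, with polynomial height-free penalties. [folklore] -/
theorem nonLWInputsTwo_window (s : Fin 2 → ℂ) (e : Fin 2 → Fin 2 ⊕ Fin 2) (μ K C A : ℝ)
    (hA : 0 < A) (hrace : A * (μ + 1) < 2 * (A + 1))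
    (hpair : CodimOneMeasure 2 (Sum.elim s (Complex.exp ∘ s) ∘ e) μ K C)
    (hfloors : ∀ i, ∃ K₁ C₁ : ℝ, SlotFloor (Sum.elim s (Complex.exp ∘ s) (e i)) A K₁ C₁) :
    1 ≤ A ∧ A < 2 ∧ 2 ≤ μ ∧ μ < 3 := by
  have hA1 : 1 ≤ A := by
    by_contra h
    push Not at h
    obtain ⟨K₁, C₁, hfl⟩ := hfloors 0
    exact slotFloor_false_of_lt_one _ A K₁ C₁ h hfl
  have hμ2 : 2 ≤ μ := by
    by_contra h
    push Not at h
    exact codimOneMeasure_false_of_lt 2 (by norm_num) _ μ K C (by exact_mod_cast h) hpair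
  refine ⟨hA1, ?_, hμ2, ?_⟩
  · nlinarith
  · nlinarith

end Summit.Schanuel.Schanuel.Cruxes.KhovanskiiApproxType.Negative

end
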